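import Mathlib.Analysis.SpecificLimits.Normed
import Mathlib.Analysis.Complex.Basic
import HarnessLib

/-!
# Pole order pinned by two limits (socket #46 of the s5 seam, hLiu418)

Track B ∕ hLiu418 = stmt-HodgeConjecture-24832, line `K2_Liu_CurveThetaSigs`, unit U6 «FIRST TERM AT THE TOP POLE: THE s5 SEAM»
(`Cruxes/HLiu418/Lines/K2_Liu_CurveThetaSigs_U6_FirstTerm.lean`, ED. 1), socket #46 `sig_K2LiuPoleOrderPinned` (SUPPORT «POLE ORDER
PINNED», size S, pure Mathlib), seat `hodgecm-mathlib-K2Liu-p06` (g0).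

If `(s − s₀) · Z(s) → ℓ` and `(s − s₀)^k · Z(s) → ρ ≠ 0` as `s → s₀`, `s ≠ s₀`, with `k ≥ 1`, then `k = 1` and `ρ = ℓ`: for `k ≥ 2`,
`(s − s₀)^k Z = (s − s₀)^{k−1} · ((s − s₀) Z) → 0 · ℓ = 0` contradicts `ρ ≠ 0`; for `k = 1` limits along the `NeBot` filter `𝓝[≠] s₀` are unique.
In the s5 seam this is the bookkeeping `k = 1 ∧ ρ = ℓ` for the doubling zeta integral `Zc` at the top pole `s₀ = ½` [Liu2021, Lem. B.12].

Theorems only; axioms ⊆ {propext, Classical.choice, Quot.sound}. The statement of `poleOrderPinned` is the socket's, byte for byte.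

HONEST LABEL: HC_CM is proved only modulo the 7 printed citations (2 remaining named inputs: hLiu418 = stmt-HodgeConjecture-24832,
h413 = stmt-HodgeConjecture-24833) until rung 0 closes; this support file moves no counter.
-/

noncomputable section

set_option autoImplicit false

set_option linter.dupNamespace false

open Filter
open scoped Topology

namespace Summit.HodgeConjecture.HodgeConjecture.Cruxes.HLiu418.K2LiuPoleOrderPinned

/-- `(s − s₀)^m → 0` as `s → s₀` within `s ≠ s₀`, for `m ≠ 0`. [folklore] -/
theorem tendsto_sub_pow_nhdsNE_zero (s₀ : ℂ) {m : ℕ} (hm : m ≠ 0) :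
    Tendsto (fun s : ℂ => (s - s₀) ^ m) (𝓝[≠] s₀) (𝓝 0) := by
  have h : Tendsto (fun s : ℂ => (s - s₀) ^ m) (𝓝 s₀) (𝓝 ((s₀ - s₀) ^ m)) :=
    ((continuous_id.sub continuous_const).pow m).tendsto s₀
  rw [sub_self, zero_pow hm] at h
  exact h.mono_left nhdsWithin_le_nhds

/-- **Socket #46 `sig_K2LiuPoleOrderPinned` — POLE ORDER PINNED.** If `(s − s₀) · Z(s) → ℓ` and `(s − s₀)^k · Z(s) → ρ ≠ 0` along
`𝓝[≠] s₀` with `1 ≤ k`, then `k = 1` and `ρ = ℓ` (for `k ≥ 2` the second function is `(s − s₀)^{k−1}` times the first and tends to `0`;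
for `k = 1` uniqueness of limits). [cite: Liu2021, Lem. B.12 pp. 103–104] -/
theorem poleOrderPinned :
    ∀ (Z : ℂ → ℂ) (s₀ ℓ ρ : ℂ) (k : ℕ), 1 ≤ k → ρ ≠ 0 →
      Tendsto (fun s => (s - s₀) * Z s) (𝓝[≠] s₀) (𝓝 ℓ) →
      Tendsto (fun s => (s - s₀) ^ k * Z s) (𝓝[≠] s₀) (𝓝 ρ) →
      k = 1 ∧ ρ = ℓ := by
  intro Z s₀ ℓ ρ k hk hρ hℓ hρlim
  -- `(s − s₀)^k Z = (s − s₀)^{k-1} · ((s − s₀) Z)`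
  have hfac : (fun s : ℂ => (s - s₀) ^ k * Z s) =
      fun s : ℂ => (s - s₀) ^ (k - 1) * ((s - s₀) * Z s) := by
    funext s
    rw [← mul_assoc, ← pow_succ, Nat.sub_add_cancel hk]
  by_cases hk1 : k = 1
  · subst hk1
    refine ⟨rfl, ?_⟩
    have hℓ' : Tendsto (fun s : ℂ => (s - s₀) ^ 1 * Z s) (𝓝[≠] s₀) (𝓝 ℓ) := by
      simpa only [pow_one] using hℓ
    exact tendsto_nhds_unique hρlim hℓ'
  · exfalso
    have hk2 : k - 1 ≠ 0 := by omega
    have h0 : Tendsto (fun s : ℂ => (s - s₀) ^ k * Z s) (𝓝[≠] s₀) (𝓝 0) := by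
      rw [hfac]
      simpa only [zero_mul] using (tendsto_sub_pow_nhdsNE_zero s₀ hk2).mul hℓ
    exact hρ (tendsto_nhds_unique hρlim h0)

end Summit.HodgeConjecture.HodgeConjecture.Cruxes.HLiu418.K2LiuPoleOrderPinned

end
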